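import Summits.QuantumFields.YangMills.Theorems.BalabanUVNodesN18TwoRunWindowLevelShift
import Summits.QuantumFields.YangMills.Theorems.BalabanUVNodesN18AtRecordOfKernelLetters

/-!
# BalabanUVNodes ∕ N18 — THE TWO-RUN WINDOW ON ONE TORUS, PART 2: the RECORD editions (merged term family of record, Stage 13) and the READING editions (W1-20's
# (1.7) localized sum under `Localizes17OfRecord₁₃`) of the run-difference road; node N18's letter OF RECORD `KernelStepRateOfRecord₁₃` from (1.21)-existence of record
# plus ONE windowed bound per `(K, k, w)` for the run-difference functional on `T^{(k+2)}_{K+1}`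
# (Track A, DAG node N18 = NE5; key K3⁷ `SpineGivenEndpointR13SepCoPH` = stmt-QuantumFields-20544, skeleton v5 941dddb108cbaacf; cell `pub-ymgap`, WIDTH SEAT
# `pub-ymgap-dag-n18-w2` g8, FILE 4; `--kind proof --supports stmt-QuantumFields-20544 --as helper`, COUNT-NEUTRAL; THEOREMS ONLY, 0 `def`, 0 `sorry`)

WHY.  PART 1 (`…N18TwoRunWindowLevelShift`) proved, for ANY term family, that W1-19b's finite-volume two-run letter at volume shift `s = 1` is a windowed (5.10)-type bound
for the RUN-DIFFERENCE functional on one torus (`windowedStepRate_one_iff_runDifference`).  K3⁷'s bill (dag-n27-w1 `K3V5Defs.keyedRatesHolderD4_rrOfRecord_of_pins_of_letters`)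
displays node N18's input as the letter OF RECORD `WindowedStepRateOfRecord₁₃ F 2 θ' (s F θ) …` (def-W1 `Node00/U3KernelLetters` §2) with the shift `s` free, and dag-n18-w1's
`…N18AtRecordOfKernelLetters` turns it, with (1.21)-existence of record, into the limit letter `KernelStepRateOfRecord₁₃` the v5 pin reads.  THIS FILE instantiates PART 1 at the
merged term family of record (§1) and at the W1 reading's localized sum (§2), so that a producer of node N18's letter of record owes, besides (1.21)-existence and the `C²`
regularity of the charts ([I] (1.9) ∕ p. 264), exactly ONE windowed bound per `(K, k, w)`: `|Π^{(K+1)}_{k+2}[𝓓^{rec}_{K,k,w}](x)| ≤ C₅θ₅·θ₅^k e^{−κ|x|₁}` for the run difference of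
the merged term of record — and, under W1-20's law `Localizes17OfRecord₁₃`, the same for the difference of the two (1.7) sums `Σ_X Re E^{(k+2)}_{K+1}(X; w; ·) − Σ_{X'} Re
E^{(k+1)}_K(X'; tail w; · ∘ shift)` on `T^{(k+2)}_{K+1}` (the termwise target of dag-n22-c's two-point machinery).

WHAT.  §1 RECORD (`θ : Stage13Params F N`; the `letI` instances of `U3KernelLetters` §2): `windowedStepRateOfRecord₁₃_one_iff_sameTorus` (pure rewriting) ·
★ `windowedStepRateOfRecord₁₃_one_iff_runDifference` (charts of record `C²` at `0`, DISPLAYED) · `windowedStepRateOfRecord₁₃_one_of_runDifference` ·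
★★ `kernelStepRateOfRecord₁₃_of_runDifference` (`PolLimitsExistOfRecord₁₃` + `C²` + run-difference bound at constant `C₅·θ₅` ⟹ `KernelStepRateOfRecord₁₃ F N θ κ θ₅ C₅`, n18-w1's
`kernelStepRateOfRecord₁₃_of_windowed'` at `s = 1`) · `n18At_u3OfRecord₁₃_objectsOfRecord₁₃_of_runDifference` (the N18 slot at the pinned kernels of record).  §2 READING (W1-20,
`S : K ↦ ClusterTower`, `emb : ReadingMaps`): `runDifference_localizedSum_apply` (`rfl`) · ★ `windowedStepRate_localizedSum_one_iff_runDifference` (any chart) ·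
★ `windowedStepRateOfRecord₁₃_one_iff_runDifference_of_localizes` (under `Localizes17OfRecord₁₃ F N θ S emb`) · `kernelStepRateOfRecord₁₃_of_runDifference_of_localizes`.

HONEST FRAMING — what this is NOT.  Count-neutral instantiation ∕ bookkeeping; NO estimate of Bałaban's is proved or asserted — the run-difference bound ([I] Thm 1's uniformity in
the spacing as a RATE, NOT PRINTED for d = 4), the (1.21)-existence of record and the `C²` regularity of the charts are DISPLAYED hypotheses (the node's content ∕ NODE A–N10's);
nothing of the merged term (1.6) or of the (2.13) terms constructed; no letter OF RECORD inhabited; N18 ∕ N22 ∕ (D4) NOT discharged; K3⁷ OPEN, not claimed; counts UNMOVED (typed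
28∕28 · discharged 5∕27 (A 5∕28)); one finite four-torus programme at fixed ε, Bałaban AS PRINTED; R4 closes the conditional finite-𝕋⁴ rung `BalabanLadder.UV` only — NOT ℝ⁴, NOT
infinite volume, NOT OS, NOT a mass gap; the Clay problem is NOT proved by any of this.

References (TYPES only): [I] = [Balaban1987RG1] (0.24)–(0.25) p. 257, Thm 1 p. 259, (1.6)–(1.7) p. 261, (1.9) p. 261, (1.20)–(1.21) p. 264, (5.10) p. 293; [II] =
[Balaban1988RG2Cluster] (2.13)–(2.14) pp. 14–15; C. King, CMP 102 (1986) [King1986] p. 665.  Imports PART 1 (p621598) and dag-n18-w1's `…N18AtRecordOfKernelLetters` (p597580) BY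
NAME; def-W1's `U3KernelLetters` ∕ `LocalizedSum17` faces cited; nothing re-declared.
-/

noncomputable section

namespace YMDAG.N18.TwoRunWindowLevelShift

open Filter
open scoped BigOperators Topology Matrix.Norms.L2Operator
open Literature.MathematicalPhysics.QuantumFieldTheory.Balaban1983to89
open Literature.MathematicalPhysics.QuantumFieldTheory.Balaban1983to89.T4Continuum (T4Family)
open Literature.MathematicalPhysics.QuantumFieldTheory.Balaban1983to89.B12Sec2to5 (l1)
open Literature.MathematicalPhysics.QuantumFieldTheory.Balaban1983to89.FlowStep (Box)
open Literature.MathematicalPhysics.QuantumFieldTheory.Balaban1983to89.B12PolarizationTensor120 (expChart)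
open Literature.MathematicalPhysics.QuantumFieldTheory.Balaban1983to89.Node00 (TermFamily1 Stage13Params U3Letters₁₁ polWindow mergedTermFamilyMatT TβOfRecord₁₃ chiβOfRecord₁₃ MatA)
open Literature.MathematicalPhysics.QuantumFieldTheory.Balaban1983to89.Node00.U3OfKernels (objectsOfRecord₁₃)
open Literature.MathematicalPhysics.QuantumFieldTheory.Balaban1983to89.Node00.U3KernelLetters (WindowedStepRate WindowedStepRateOfRecord₁₃ PolLimitsExistOfRecord₁₃
  KernelStepRateOfRecord₁₃ windowedStepRateOfRecord₁₃_iff_of_localizes)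
open Literature.MathematicalPhysics.QuantumFieldTheory.Balaban1983to89.Node00.LocalizedSum17 (localizedSum ReadingMaps Localizes17OfRecord₁₃)
open Literature.MathematicalPhysics.QuantumFieldTheory.Balaban1983to89.Node00.Sect2 (domSys)
open Literature.MathematicalPhysics.QuantumFieldTheory.Balaban1983to89.Node00.W1 (ClusterTower)
open Literature.MathematicalPhysics.QuantumFieldTheory.Balaban1983to89.T4LevelShift (siteShift)
open YMDAG.UVSplit (N18At u3OfRecord₁₃)
open YMDAG.N18.AtRecordOfKernelLetters (kernelStepRateOfRecord₁₃_of_windowed' n18At_u3OfRecord₁₃_objectsOfRecord₁₃_of_kernelStepRateOfRecord₁₃)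

/-! ## §1 RECORD editions: the merged term family of record, Stage 13 -/

section Record

variable (F : T4Family) (N : ℕ) [NeZero N]

/-- **THE TWO-RUN LETTER OF RECORD AT `s = 1` ON ONE TORUS** (pure rewriting, no hypothesis): run A's window of the merged term of record is read on run B's torus
`T^{(k+2)}_{K+1}` through the level shift along `ladder F K k`. [cite: Balaban1987RG1, Thm 1 p.259 and (1.20)–(1.21) p.264] -/
theorem windowedStepRateOfRecord₁₃_one_iff_sameTorus (θ : Stage13Params F N) (κ θ₅ C' : ℝ) :
    WindowedStepRateOfRecord₁₃ F N θ 1 κ θ₅ C' ↔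
      (letI := θ.instVβ₁; letI := θ.instVβ₂; letI := θ.instιβ
       ∀ (k : ℕ) (w : Fin (k + 2) → ℝ), w ∈ Box θ.γ (k + 1) → ∀ (μ ν : Fin 4) (x : Fin 4 → ℤ), ∀ᶠ K in atTop,
        |polWindow F (K + 1) (k + 1 + 1) (mergedTermFamilyMatT F N (TβOfRecord₁₃ F N) (chiβOfRecord₁₃ F N θ) θ.εbg (k + 1) w (K + 1)) θ.ρ8 θ.bV μ ν x -
            polWindow F (K + 1) (k + 1 + 1)
              (fun W' : Fin (F.P (K + 1)).d → Site (F.P (K + 1)) (k + 1 + 1) → MatA N =>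
                mergedTermFamilyMatT F N (TβOfRecord₁₃ F N) (chiβOfRecord₁₃ F N θ) θ.εbg k (Fin.tail w) K (fun κ y => W' κ (siteShift (ladder F K k) y))) θ.ρ8 θ.bV μ ν x| ≤
          C' * θ₅ ^ k * Real.exp (-κ * l1 x)) := by
  letI := θ.instVβ₁; letI := θ.instVβ₂; letI := θ.instιβ
  exact windowedStepRate_one_iff_sameTorus F _ θ.ρ8 θ.bV θ.γ κ θ₅ C'

/-- ★ **NODE N18's FINITE-VOLUME LETTER OF RECORD AS A WINDOWED BOUND FOR THE RUN DIFFERENCE OF THE MERGED TERM OF RECORD** (the charts of the merged term family of record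
`C²` at `0` — [I] (1.9) ∕ p. 264 analyticity — DISPLAYED as `hC`): `WindowedStepRateOfRecord₁₃ F N θ 1 κ θ₅ C'` iff for every box history, direction pair and separation,
EVENTUALLY in `K`, `|Π^{(K+1)}_{k+2}[𝓓^{rec}_{K,k,w}](x)| ≤ C'θ₅^k e^{−κ|x|₁}` with `𝓓^{rec}_{K,k,w} W' := 𝓝_{k+2}(w; W') − 𝓝_{k+1}(tail w; W' ∘ shift)` on `T^{(k+2)}_{K+1}`.
[cite: Balaban1987RG1, Thm 1 p.259, (1.6) p.261, (1.20)–(1.21) p.264 and (5.10) p.293; King1986, p.665] -/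
theorem windowedStepRateOfRecord₁₃_one_iff_runDifference (θ : Stage13Params F N)
    (hC : letI := θ.instVβ₁; letI := θ.instVβ₂
      ∀ (k : ℕ) (hist : Fin (k + 1) → ℝ) (K : ℕ), ContDiffAt ℝ 2 (expChart (mergedTermFamilyMatT F N (TβOfRecord₁₃ F N) (chiβOfRecord₁₃ F N θ) θ.εbg k hist K) θ.ρ8) 0)
    (κ θ₅ C' : ℝ) :
    WindowedStepRateOfRecord₁₃ F N θ 1 κ θ₅ C' ↔
      (letI := θ.instVβ₁; letI := θ.instVβ₂; letI := θ.instιβ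
       ∀ (k : ℕ) (w : Fin (k + 2) → ℝ), w ∈ Box θ.γ (k + 1) → ∀ (μ ν : Fin 4) (x : Fin 4 → ℤ), ∀ᶠ K in atTop,
        |polWindow F (K + 1) (k + 1 + 1)
            (fun W' : Fin (F.P (K + 1)).d → Site (F.P (K + 1)) (k + 1 + 1) → MatA N =>
              mergedTermFamilyMatT F N (TβOfRecord₁₃ F N) (chiβOfRecord₁₃ F N θ) θ.εbg (k + 1) w (K + 1) W' -
                mergedTermFamilyMatT F N (TβOfRecord₁₃ F N) (chiβOfRecord₁₃ F N θ) θ.εbg k (Fin.tail w) K (fun κ y => W' κ (siteShift (ladder F K k) y))) θ.ρ8 θ.bV μ ν x| ≤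
          C' * θ₅ ^ k * Real.exp (-κ * l1 x)) := by
  letI := θ.instVβ₁; letI := θ.instVβ₂; letI := θ.instιβ
  exact windowedStepRate_one_iff_runDifference F _ θ.ρ8 θ.bV hC θ.γ κ θ₅ C'

/-- The producer's direction alone at the record. [cite: Balaban1987RG1, Thm 1 p.259 and (5.10) p.293] -/
theorem windowedStepRateOfRecord₁₃_one_of_runDifference (θ : Stage13Params F N)
    (hC : letI := θ.instVβ₁; letI := θ.instVβ₂
      ∀ (k : ℕ) (hist : Fin (k + 1) → ℝ) (K : ℕ), ContDiffAt ℝ 2 (expChart (mergedTermFamilyMatT F N (TβOfRecord₁₃ F N) (chiβOfRecord₁₃ F N θ) θ.εbg k hist K) θ.ρ8) 0)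
    {κ θ₅ C' : ℝ}
    (h : letI := θ.instVβ₁; letI := θ.instVβ₂; letI := θ.instιβ
      ∀ (k : ℕ) (w : Fin (k + 2) → ℝ), w ∈ Box θ.γ (k + 1) → ∀ (μ ν : Fin 4) (x : Fin 4 → ℤ), ∀ᶠ K in atTop,
        |polWindow F (K + 1) (k + 1 + 1)
            (fun W' : Fin (F.P (K + 1)).d → Site (F.P (K + 1)) (k + 1 + 1) → MatA N =>
              mergedTermFamilyMatT F N (TβOfRecord₁₃ F N) (chiβOfRecord₁₃ F N θ) θ.εbg (k + 1) w (K + 1) W' -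
                mergedTermFamilyMatT F N (TβOfRecord₁₃ F N) (chiβOfRecord₁₃ F N θ) θ.εbg k (Fin.tail w) K (fun κ y => W' κ (siteShift (ladder F K k) y))) θ.ρ8 θ.bV μ ν x| ≤
          C' * θ₅ ^ k * Real.exp (-κ * l1 x)) :
    WindowedStepRateOfRecord₁₃ F N θ 1 κ θ₅ C' :=
  (windowedStepRateOfRecord₁₃_one_iff_runDifference F N θ hC κ θ₅ C').2 h

/-- ★★ **NODE N18's LETTER OF RECORD FROM (1.21)-EXISTENCE OF RECORD + ONE WINDOWED BOUND PER `(K, k, w)` FOR THE RUN DIFFERENCE**: `PolLimitsExistOfRecord₁₃ F N θ`, `C²`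
charts of record and the run-difference bound with constant `C₅·θ₅` give `KernelStepRateOfRecord₁₃ F N θ κ θ₅ C₅` — the letter K3⁷'s v5 pin reads for node N18
(dag-n18-w1's `kernelStepRateOfRecord₁₃_of_windowed'` at `s = 1`). [cite: Balaban1987RG1, Thm 1 p.259, (1.21) p.264 and (5.10) p.293] -/
theorem kernelStepRateOfRecord₁₃_of_runDifference (θ : Stage13Params F N) (hex : PolLimitsExistOfRecord₁₃ F N θ)
    (hC : letI := θ.instVβ₁; letI := θ.instVβ₂
      ∀ (k : ℕ) (hist : Fin (k + 1) → ℝ) (K : ℕ), ContDiffAt ℝ 2 (expChart (mergedTermFamilyMatT F N (TβOfRecord₁₃ F N) (chiβOfRecord₁₃ F N θ) θ.εbg k hist K) θ.ρ8) 0)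
    {κ θ₅ C₅ : ℝ}
    (h : letI := θ.instVβ₁; letI := θ.instVβ₂; letI := θ.instιβ
      ∀ (k : ℕ) (w : Fin (k + 2) → ℝ), w ∈ Box θ.γ (k + 1) → ∀ (μ ν : Fin 4) (x : Fin 4 → ℤ), ∀ᶠ K in atTop,
        |polWindow F (K + 1) (k + 1 + 1)
            (fun W' : Fin (F.P (K + 1)).d → Site (F.P (K + 1)) (k + 1 + 1) → MatA N =>
              mergedTermFamilyMatT F N (TβOfRecord₁₃ F N) (chiβOfRecord₁₃ F N θ) θ.εbg (k + 1) w (K + 1) W' -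
                mergedTermFamilyMatT F N (TβOfRecord₁₃ F N) (chiβOfRecord₁₃ F N θ) θ.εbg k (Fin.tail w) K (fun κ y => W' κ (siteShift (ladder F K k) y))) θ.ρ8 θ.bV μ ν x| ≤
          C₅ * θ₅ * θ₅ ^ k * Real.exp (-κ * l1 x)) :
    KernelStepRateOfRecord₁₃ F N θ κ θ₅ C₅ :=
  kernelStepRateOfRecord₁₃_of_windowed' F N θ 1 hex (windowedStepRateOfRecord₁₃_one_of_runDifference F N θ hC h)

/-- **THE N18 SLOT AT THE PINNED KERNELS OF RECORD** (letter block `ℓ`, every run length `k`) from the same three inputs at `(ℓ.κ, ℓ.θ₅, ℓ.C₅)`.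
[cite: Balaban1987RG1, Thm 1 p.259 and (1.20)–(1.22) p.264] -/
theorem n18At_u3OfRecord₁₃_objectsOfRecord₁₃_of_runDifference (θ : Stage13Params F N) (ℓ : U3Letters₁₁) (hex : PolLimitsExistOfRecord₁₃ F N θ)
    (hC : letI := θ.instVβ₁; letI := θ.instVβ₂
      ∀ (k : ℕ) (hist : Fin (k + 1) → ℝ) (K : ℕ), ContDiffAt ℝ 2 (expChart (mergedTermFamilyMatT F N (TβOfRecord₁₃ F N) (chiβOfRecord₁₃ F N θ) θ.εbg k hist K) θ.ρ8) 0)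
    (h : letI := θ.instVβ₁; letI := θ.instVβ₂; letI := θ.instιβ
      ∀ (k : ℕ) (w : Fin (k + 2) → ℝ), w ∈ Box θ.γ (k + 1) → ∀ (μ ν : Fin 4) (x : Fin 4 → ℤ), ∀ᶠ K in atTop,
        |polWindow F (K + 1) (k + 1 + 1)
            (fun W' : Fin (F.P (K + 1)).d → Site (F.P (K + 1)) (k + 1 + 1) → MatA N =>
              mergedTermFamilyMatT F N (TβOfRecord₁₃ F N) (chiβOfRecord₁₃ F N θ) θ.εbg (k + 1) w (K + 1) W' -
                mergedTermFamilyMatT F N (TβOfRecord₁₃ F N) (chiβOfRecord₁₃ F N θ) θ.εbg k (Fin.tail w) K (fun κ y => W' κ (siteShift (ladder F K k) y))) θ.ρ8 θ.bV μ ν x| ≤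
          ℓ.C₅ * ℓ.θ₅ * ℓ.θ₅ ^ k * Real.exp (-ℓ.κ * l1 x))
    (k : ℕ) : N18At (u3OfRecord₁₃ θ (objectsOfRecord₁₃ F N θ ℓ) k) :=
  n18At_u3OfRecord₁₃_objectsOfRecord₁₃_of_kernelStepRateOfRecord₁₃ F N θ ℓ k (kernelStepRateOfRecord₁₃_of_runDifference F N θ hex hC h)

end Record

/-! ## §2 READING editions: W1-20's (1.7) localized sum, and the letter of record under `Localizes17OfRecord₁₃` -/

section Reading

variable {𝔄 : Type*} [NormedRing 𝔄] [NormedAlgebra ℝ 𝔄] {V : Type*} [NormedAddCommGroup V] [NormedSpace ℝ V] {ι : Type*} [Fintype ι] {𝔸 : Type*} {M : ℕ}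
variable (F : T4Family) (S : (K : ℕ) → ClusterTower (F.P K) 𝔸 M) (emb : ReadingMaps F 𝔄 𝔸) (ρ : V →L[ℝ] 𝔄) (bV : Module.Basis ι ℝ V)

omit [NormedRing 𝔄] [NormedAlgebra ℝ 𝔄] in
/-- **THE RUN DIFFERENCE OF THE (1.7) LOCALIZED SUM, UNFOLDED** (`rfl`): on `T^{(k+2)}_{K+1}` it is the difference of the two finite-volume sums of (2.13) terms — run B's sum over
the scale-`(k+2)` localization domains of the `(K+1)`-th torus at history `w`, minus run A's sum over the scale-`(k+1)` domains of the `K`-th torus at `tail w`, read through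
the level shift — the termwise target. [cite: Balaban1987RG1, (1.7) p.261; Balaban1988RG2Cluster, (2.13) p.14 and (2.14) p.15] -/
theorem runDifference_localizedSum_apply (K k : ℕ) (w : Fin (k + 2) → ℝ) (W' : Fin (F.P (K + 1)).d → Site (F.P (K + 1)) (k + 1 + 1) → 𝔄) :
    localizedSum F S emb (k + 1) w (K + 1) W' - localizedSum F S emb k (Fin.tail w) K (fun κ y => W' κ (siteShift (ladder F K k) y)) =
      (∑ X : (domSys (F.P (K + 1)) M (k + 1 + 1)).Dom, (((S (K + 1)) (k + 1)).E w (emb (K + 1) (k + 1) W') X).re) -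
        ∑ X : (domSys (F.P K) M (k + 1)).Dom, (((S K) k).E (Fin.tail w) (emb K k (fun κ y => W' κ (siteShift (ladder F K k) y))) X).re := rfl

/-- ★ **THE TWO-RUN LETTER OF THE LOCALIZED SUM AS A WINDOWED BOUND FOR ITS RUN DIFFERENCE** (any chart `ρ, bV`; the localized sum's charts `C²` at `0`, DISPLAYED).
[cite: Balaban1987RG1, Thm 1 p.259, (1.7) p.261 and (1.20)–(1.21) p.264] -/
theorem windowedStepRate_localizedSum_one_iff_runDifference (hC : ∀ (k : ℕ) (hist : Fin (k + 1) → ℝ) (K : ℕ), ContDiffAt ℝ 2 (expChart (localizedSum F S emb k hist K) ρ) 0)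
    (γ κ θ C' : ℝ) :
    WindowedStepRate F (localizedSum F S emb) ρ bV γ 1 κ θ C' ↔
      ∀ (k : ℕ) (w : Fin (k + 2) → ℝ), w ∈ Box γ (k + 1) → ∀ (μ ν : Fin 4) (x : Fin 4 → ℤ), ∀ᶠ K in atTop,
        |polWindow F (K + 1) (k + 1 + 1)
            (fun W' : Fin (F.P (K + 1)).d → Site (F.P (K + 1)) (k + 1 + 1) → 𝔄 =>
              localizedSum F S emb (k + 1) w (K + 1) W' - localizedSum F S emb k (Fin.tail w) K (fun κ y => W' κ (siteShift (ladder F K k) y))) ρ bV μ ν x| ≤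
          C' * θ ^ k * Real.exp (-κ * l1 x) :=
  windowedStepRate_one_iff_runDifference F _ ρ bV hC γ κ θ C'

variable (N : ℕ) [NeZero N]

/-- ★ **UNDER W1-20's LAW THE LETTER OF RECORD IS THE RUN-DIFFERENCE BOUND FOR THE READING's LOCALIZED SUM**: `Localizes17OfRecord₁₃ F N θ S emb` (the merged term of record IS
the (1.7) sum of the cluster expansion's terms from the run length at which the level exists on) + `C²` charts of the localized sum in the record's β-chart ⟹
`WindowedStepRateOfRecord₁₃ F N θ 1 κ θ₅ C'` iff the windowed bound for the run difference of `localizedSum F S emb` holds (def-W1's `windowedStepRateOfRecord₁₃_iff_of_localizes`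
∘ §2's iff). [cite: Balaban1987RG1, (1.7) p.261, Thm 1 p.259 and (1.20)–(1.21) p.264; Balaban1988RG2Cluster, (2.14) p.15] -/
theorem windowedStepRateOfRecord₁₃_one_iff_runDifference_of_localizes (θ : Stage13Params F N) (S : (K : ℕ) → ClusterTower (F.P K) 𝔸 M) (emb : ReadingMaps F (MatA N) 𝔸)
    (hloc : Localizes17OfRecord₁₃ F N θ S emb)
    (hC : letI := θ.instVβ₁; letI := θ.instVβ₂
      ∀ (k : ℕ) (hist : Fin (k + 1) → ℝ) (K : ℕ), ContDiffAt ℝ 2 (expChart (localizedSum F S emb k hist K) θ.ρ8) 0)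
    (κ θ₅ C' : ℝ) :
    WindowedStepRateOfRecord₁₃ F N θ 1 κ θ₅ C' ↔
      (letI := θ.instVβ₁; letI := θ.instVβ₂; letI := θ.instιβ
       ∀ (k : ℕ) (w : Fin (k + 2) → ℝ), w ∈ Box θ.γ (k + 1) → ∀ (μ ν : Fin 4) (x : Fin 4 → ℤ), ∀ᶠ K in atTop,
        |polWindow F (K + 1) (k + 1 + 1)
            (fun W' : Fin (F.P (K + 1)).d → Site (F.P (K + 1)) (k + 1 + 1) → MatA N =>
              localizedSum F S emb (k + 1) w (K + 1) W' - localizedSum F S emb k (Fin.tail w) K (fun κ y => W' κ (siteShift (ladder F K k) y))) θ.ρ8 θ.bV μ ν x| ≤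
          C' * θ₅ ^ k * Real.exp (-κ * l1 x)) := by
  letI := θ.instVβ₁; letI := θ.instVβ₂; letI := θ.instιβ
  rw [windowedStepRateOfRecord₁₃_iff_of_localizes F N θ S emb hloc 1 κ θ₅ C']
  exact windowedStepRate_localizedSum_one_iff_runDifference F S emb θ.ρ8 θ.bV hC θ.γ κ θ₅ C'

/-- **NODE N18's LETTER OF RECORD FROM THE READING**: under W1-20's law, (1.21)-existence of record, `C²` charts of the localized sum and the run-difference bound for the
localized sum at constant `C₅·θ₅` give `KernelStepRateOfRecord₁₃ F N θ κ θ₅ C₅`. [cite: Balaban1987RG1, Thm 1 p.259, (1.7) p.261 and (1.21) p.264] -/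
theorem kernelStepRateOfRecord₁₃_of_runDifference_of_localizes (θ : Stage13Params F N) (S : (K : ℕ) → ClusterTower (F.P K) 𝔸 M) (emb : ReadingMaps F (MatA N) 𝔸)
    (hloc : Localizes17OfRecord₁₃ F N θ S emb) (hex : PolLimitsExistOfRecord₁₃ F N θ)
    (hC : letI := θ.instVβ₁; letI := θ.instVβ₂
      ∀ (k : ℕ) (hist : Fin (k + 1) → ℝ) (K : ℕ), ContDiffAt ℝ 2 (expChart (localizedSum F S emb k hist K) θ.ρ8) 0)
    {κ θ₅ C₅ : ℝ}
    (h : letI := θ.instVβ₁; letI := θ.instVβ₂; letI := θ.instιβ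
      ∀ (k : ℕ) (w : Fin (k + 2) → ℝ), w ∈ Box θ.γ (k + 1) → ∀ (μ ν : Fin 4) (x : Fin 4 → ℤ), ∀ᶠ K in atTop,
        |polWindow F (K + 1) (k + 1 + 1)
            (fun W' : Fin (F.P (K + 1)).d → Site (F.P (K + 1)) (k + 1 + 1) → MatA N =>
              localizedSum F S emb (k + 1) w (K + 1) W' - localizedSum F S emb k (Fin.tail w) K (fun κ y => W' κ (siteShift (ladder F K k) y))) θ.ρ8 θ.bV μ ν x| ≤
          C₅ * θ₅ * θ₅ ^ k * Real.exp (-κ * l1 x)) :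
    KernelStepRateOfRecord₁₃ F N θ κ θ₅ C₅ :=
  kernelStepRateOfRecord₁₃_of_windowed' F N θ 1 hex ((windowedStepRateOfRecord₁₃_one_iff_runDifference_of_localizes F N θ S emb hloc hC κ θ₅ (C₅ * θ₅)).2 h)

end Reading

end YMDAG.N18.TwoRunWindowLevelShift

end
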